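import Literature.NumberTheory.LFunctions.LagariasDifferencedXiDefs
import Literature.NumberTheory.LFunctions.LagariasXiShiftHermiteBiehler
import Literature.NumberTheory.LFunctions.SuzukiCanonicalSystem
import Literature.NumberTheory.LFunctions.ZetaLogDerivRH
import Literature.Analysis.DeBrangesSpaces.Basic
import HarnessLib

/-!
# Lagarias' differenced `ξ`-functions: Lemma 2.1 (2), Lemma 2.2, Theorems 2.1 and 3.1 (Lagarias 2005, §2–§3)

LINE 1 — LABEL: RH-FREE corpus typing (cell rh-crit/dbl, corpus C2, source S5, typer t4). The unconditional
statements (Lemma 2.2, Theorem 2.1 (1), Theorem 3.1 (1)) are RH-FREE literature; Lemma 2.1 (2), Theorem 2.1 (2)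
and Theorem 3.1 (2) are RH-CONSEQUENCES, printed "Assuming the Riemann hypothesis", and carry the explicit
binder `RiemannHypothesis → …` (never dropped, never asserted). bears_on: LADDER-RH B-C/B-P (COLUMN 6,
de Branges). WHAT THIS IS NOT: not a route, not a proof plan for RH, no positivity condition at `E_ζ` is asserted
(Conrey–Li guard); typing these theorems fixes vocabulary, it does not move RH; nothing here bears on the truth
of RH.

Source: J. C. Lagarias, *Zero spacing distributions for differenced L-functions*, Acta Arith. 120 (2005),
no. 2, 159–184, doi:10.4064/aa120-2-4 = arXiv:math/0601653 [Lagarias2005] (held: `paper:arxiv-math_0601653`;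
read at the chunk locators §2 = p0004–p0006, §3 = p0007 of the held text; arXiv-version pages: Lemma 2.1
pp. 4–5, Lemma 2.2 p. 6, Theorem 2.1 p. 8, Theorem 3.1 p. 9). The OBJECTS of §2 — `E_h`, `E_{h,θ}`, `A_h`,
`B_h`, `A_{h,θ}`, `B_{h,θ}` (`diffXiE`, `diffXiErot`, `diffXiA`, `diffXiB`, `diffXiArot`, `diffXiBrot`), the
`s`-variable involution `E♯(s) = conj E(1 − s̄)` and the decomposition `E = A − iB` of Lemma 2.2 (`critReflect`,
`critRePart`, `critImPart`), and the counting vocabulary (`critZeroOrdinates`, `AllZerosOnCriticalLine`,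
`AllZerosSimple`, `critZeroCountOn`, `CritZerosInterlace`, `stripZeroCount` = `N(T, F)`) — are the cell's shared
definitions module `LagariasDifferencedXiDefs.lean` (typer t5), CITED, not restated. This module adds the
numbered STATEMENTS of §2–§3, AS PRINTED, in Lagarias' `s`-variable:

* **Lemma 2.1 (2)** (RH ⟹ `|ξ(h + s)| > |ξ(h + 1 − s̄)|` on `Re s > ½` for every `h > 0`) — PROVED
  (`lagarias2005_lemma_2_1_2`) from the tree's Hadamard-product comparison under a zero-free half-plane
  (`norm_riemannXi_shift_reflect_lt_of_zeroFree`, SuzukiCanonicalSystem.lean) and RH-zero-freeness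
  (`riemannZeta_ne_zero_of_riemannHypothesis`); part (1) is the tree's `lagarias2005_lemma_2_1(_holds)`
  (LagariasXiShiftHermiteBiehler{,Proofs}.lean), CITED. Hence `E_{h,θ}` satisfies hypothesis (2.6) of Lemma 2.2
  for `h ≥ ½`, and for `h > 0` under RH (`diffXiErot_critHB`, `diffXiErot_critHB_rh`; for `h ≤ −½` the
  inequality is reversed, cf. `not_isHermiteBiehler_xiShift_neg` in the §4–6 module).
* **Lemma 2.2** (de Branges' lemma [deB59] in the `s`-variable): first conclusion (all zeros of `A`, `B` on the
  critical line) PROVED (`lagarias2005_lemma_2_2_zeros`: the printed three-line argument; entireness is not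
  used); second conclusion (the zeros interlace, counting multiplicity — Remark (1)) = NAMED FACT
  `lagarias2005_lemma_2_2_interlace` over the Defs module's `CritZerosInterlace`. The printed proof shows the
  phase `φ` of `E(½+it)` is strictly increasing ((2.7)–(2.8)); the multiplicity clause needs `φ′ > 0`,
  de Branges' form. The rotation remark (`E_θ = e^{iθ}E` again satisfies (2.6)) is `critHB_rotate`.
* The DICTIONARY to the tree's `z`-variable de Branges vocabulary (`s = ½ − iz`):
  `critReflect E (½ − iz) = sharp (E ∘ (½ − i·)) z` and (2.6) ⟺
  `Literature.Analysis.DeBrangesSpaces.IsHermiteBiehler (E ∘ (½ − i·))` (the inequality-only predicate of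
  Basic.lean, as the cell prescribes; no new Hermite–Biehler predicate is introduced — hypothesis (2.6) is
  written out where Lagarias writes it out): `critReflect_half_sub_I_mul`, `isHermiteBiehler_half_sub_I_mul_iff`.
* **Theorem 2.1** (1) `|h| ≥ ½` unconditional / (2) `0 < |h| < ½` under RH: zeros of `A_{h,θ}`, `B_{h,θ}` on the
  line, simple, interlacing — NAMED FACTS `lagarias2005_thm_2_1_1/_2`, in the same shape as the §5 analogue
  `lagarias2005_thm_5_1_1/_2` (discharged in the sibling `LagariasDifferencedXiProofs.lean`: on `Re s = ½ + h`
  the phase of `ξ` has velocity `Re ξ′/ξ > 0`, tree `Lagarias1999Eq14.re_logDeriv_riemannXi_pos_of_one_le_re` /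
  `Lagarias1999_riemannHypothesis_iff_holds`, which gives simplicity and alternation). The values
  `A_{h,θ}(½+it) = Re(e^{iθ}ξ(½+it+h))`, `B_{h,θ}(½+it) = −Im(…)` (`diffXiArot_critical`, `diffXiBrot_critical`)
  and the sign-corrected printed symmetry `B_h(s̄) = −conj B_h(s)` (`diffXiB_conj`; the text says "similarly"
  to `A_h(s̄) = conj A_h(s)` = the Defs module's `diffXiA_conj`) are PROVED here.
* **Theorem 3.1** (1)/(2): `N(T, A_{h,θ}) = (1/π)T log T − (1/π)(log 2π + 1)T + O(log T)`, `T ≥ 2` — NAMED FACTS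
  `lagarias2005_thm_3_1_1/_2` with `N(T,F)` = `stripZeroCount` and main term `lagariasZeroCountMain`, the
  constant uniform in `θ` but allowed to depend on `h`: the printed "independent of `h` and `θ`" cannot hold
  over all `|h| ≥ ½` (for fixed `T` the count `N(T, A_{h,θ})` → ∞ as `h → ∞`, the phase of `ξ(½+h+it)`
  having velocity `Re ξ′/ξ ≍ ½ log h`; the printed proof treats `h` as fixed, the `h`-dependence of (3.4)
  sitting in its `O`-term) — the only deviation from print, and it weakens nothing that is true; printed
  "`|T| ≥ 2`" read as `T ≥ 2`. Inputs of the printed proof: argument principle, Stirling, `arg ζ(σ+it) = O(log t)`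
  on a zero-free half-plane — the inputs of the tree's (undischarged) `riemann_von_mangoldt`.

Deliberately NOT here: §1, Remark (2) after Lemma 2.2 ("it can be shown that there exist entire functions of
fast growth … satisfying (2.6)"), the unnumbered remark after Theorem 3.1 on Ki's and Levinson's counts for
`ζ̂` ([Ki04], [Le71]), §4–§6 (`LagariasDifferencedXiSpacings.lean`, typer t5, incl. Lemma 6.1 (i)/(ii)).
-/

noncomputable section

open Complex Set
open scoped ComplexConjugate Real

namespace Literature.NumberTheory.LFunctions

/-! ## The `s`-variable and the `z`-variable (`s = ½ − iz`) -/

/-- Lagarias' `E♯(s) = conj E(1 − s̄)` (`critReflect`) is de Branges' `E♯(z) = conj E(z̄)`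
(`Literature.Analysis.DeBrangesSpaces.sharp`) under `s = ½ − iz` ("the de Branges theory is formulated in terms of
a variable `z` with `s = ½ − iz` … here we re-express de Branges's result in terms of the `s`-variable, and the
involution becomes `E♯(s) = conj E(1 − s̄)`"). [cite: Lagarias2005, §2, before Lemma 2.2 (arXiv p. 6; held text p0005)] -/
theorem critReflect_half_sub_I_mul (E : ℂ → ℂ) (z : ℂ) :
    critReflect E (1 / 2 - I * z) = Literature.Analysis.DeBrangesSpaces.sharp (fun z ↦ E (1 / 2 - I * z)) z := by
  simp only [critReflect_apply, Literature.Analysis.DeBrangesSpaces.sharp_apply, map_sub, map_mul,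
    Complex.conj_I, map_div₀, map_one, map_ofNat]
  ring_nf

/-- Lagarias' hypothesis (2.6) `|E(s)| > |E(1 − s̄)|` for `Re s > ½` IS the Hermite–Biehler inequality of
`Literature.Analysis.DeBrangesSpaces.IsHermiteBiehler` for `z ↦ E(½ − iz)` (which also records that `E` is
entire). [cite: Lagarias2005, §2, before Lemma 2.2 (arXiv p. 6; held text p0005)] -/
theorem isHermiteBiehler_half_sub_I_mul_iff (E : ℂ → ℂ) :
    Literature.Analysis.DeBrangesSpaces.IsHermiteBiehler (fun z ↦ E (1 / 2 - I * z)) ↔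
      Differentiable ℂ E ∧ ∀ s : ℂ, 1 / 2 < s.re → ‖E (1 - conj s)‖ < ‖E s‖ := by
  have key : ∀ z : ℂ, (1 : ℂ) - conj (1 / 2 - I * z) = 1 / 2 - I * conj z := by
    intro z
    simp only [map_sub, map_mul, Complex.conj_I, map_div₀, map_one, map_ofNat]
    ring
  constructor
  · rintro ⟨hd, hlt⟩
    refine ⟨?_, fun s hs ↦ ?_⟩
    · have : E = (fun z ↦ E (1 / 2 - I * z)) ∘ fun s ↦ I * (s - 1 / 2) := by
        funext s; simp only [Function.comp_apply]; congr 1; ring_nf; rw [I_sq]; ring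
      rw [this]
      exact hd.comp ((differentiable_id.sub (differentiable_const _)).const_mul _)
    · have hz : 0 < (I * (s - 1 / 2)).im := by simp; linarith
      have h := hlt _ hz
      have e1 : (1 / 2 : ℂ) - I * (I * (s - 1 / 2)) = s := by ring_nf; rw [I_sq]; ring
      have e2 : (1 / 2 : ℂ) - I * conj (I * (s - 1 / 2)) = 1 - conj s := by
        simp only [map_mul, Complex.conj_I, map_sub, map_div₀, map_one, map_ofNat]
        ring_nf; rw [I_sq]; ring
      simp only [e1, e2] at h
      exact h
  · rintro ⟨hd, hlt⟩
    refine ⟨hd.comp ((differentiable_const _).sub (differentiable_id.const_mul _)), fun z hz ↦ ?_⟩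
    have hs : (1 / 2 : ℝ) < ((1 / 2 : ℂ) - I * z).re := by simp [hz]
    have h := hlt _ hs
    rwa [key] at h

/-- If `E` satisfies (2.6) then so does `E_θ := e^{iθ} E` ("If a function `E(s) = A(s) − iB(s)` satisfies the
hypothesis of Lemma 2.2 then so does the function `E_θ(s) = e^{iθ}E(s)`"; the components rotate by
`critRePart_rotate` / `critImPart_rotate`). [cite: Lagarias2005, §2, after the proof of Lemma 2.2 (arXiv p. 7; held text p0005)] -/
theorem critHB_rotate {E : ℂ → ℂ} (hE : ∀ s : ℂ, 1 / 2 < s.re → ‖E (1 - conj s)‖ < ‖E s‖) (θ : ℝ) :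
    ∀ s : ℂ, 1 / 2 < s.re → ‖cexp (θ * I) * E (1 - conj s)‖ < ‖cexp (θ * I) * E s‖ := by
  intro s hs
  have h1 : ‖cexp (θ * I)‖ = 1 := by rw [Complex.norm_exp]; simp
  simpa [norm_mul, h1] using hE s hs

/-! ## Lemma 2.2 -/

/-- **Lagarias 2005, Lemma 2.2, first conclusion** (de Branges [deB59]) — RH-FREE, PROVED: if `E` satisfies
`|E(s)| > |E(1 − s̄)|` for `Re s > ½` (2.6), then `A(s) = ½(E(s) + conj E(1−s̄))` (`critRePart E`) and
`B(s) = −(1/2i)(E(s) − conj E(1−s̄))` (`critImPart E`) have all their zeros on the critical line `Re s = ½`.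
Printed proof: for `Re s > ½`, `|A(s)| ≥ |E(s)| − |E(1−s̄)| > 0`; for `Re s < ½` apply (2.6) at `1 − s̄`;
likewise for `B`. Entireness of `E` is not used. [cite: Lagarias2005, Lemma 2.2 (arXiv p. 6; held text p0005 L12)] -/
theorem lagarias2005_lemma_2_2_zeros {E : ℂ → ℂ} (hE : ∀ s : ℂ, 1 / 2 < s.re → ‖E (1 - conj s)‖ < ‖E s‖) :
    AllZerosOnCriticalLine (critRePart E) ∧ AllZerosOnCriticalLine (critImPart E) := by
  -- off the critical line the two norms differ
  have hne : ∀ s : ℂ, s.re ≠ 1 / 2 → ‖E s‖ ≠ ‖critReflect E s‖ := by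
    intro s hs
    rw [critReflect_apply, Complex.norm_conj]
    rcases lt_or_gt_of_ne hs with h | h
    · have h' : (1 / 2 : ℝ) < (1 - conj s).re := by simp; linarith
      have := hE _ h'
      have e : (1 : ℂ) - conj (1 - conj s) = s := by simp
      rw [e] at this
      exact this.ne
    · exact (hE s h).ne'
  constructor
  · intro s h0
    by_contra hs
    apply hne s hs
    have : E s = -critReflect E s := by
      rw [critRePart] at h0
      linear_combination 2 * h0
    rw [this, norm_neg]
  · intro s h0
    by_contra hs
    apply hne s hs
    have : E s = critReflect E s := by
      rw [critImPart] at h0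
      have h2 : I * (E s - critReflect E s) = 0 := by
        linear_combination 2 * h0
      rcases mul_eq_zero.1 h2 with hI | h3
      · exact absurd hI I_ne_zero
      · exact sub_eq_zero.1 h3
    rw [this]

/-- NAMED FACT — **Lagarias 2005, Lemma 2.2, second conclusion** (de Branges' lemma [deB59]) — RH-FREE: if `E`
is entire and `|E(s)| > |E(1 − s̄)|` for `Re s > ½` (2.6), then the (critical-line) zeros of
`A(s) = ½(E(s) + conj E(1−s̄))` and `B(s) = −(1/2i)(E(s) − conj E(1−s̄))` interlace, counting multiplicity —
Remark (1): "there is a numbering of zeros of the two functions, `{ρ_n(A) = ½ + iγ_n(A) : n ∈ ℤ}`, resp.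
`{ρ_n(B) = ½ + iγ_n(B) : n ∈ ℤ}`, with imaginary parts in increasing order, counting zeros with
multiplicity, such that `γ_n(A) ≤ γ_n(B) ≤ γ_{n+1}(A)` holds for all allowed `n`" — in the Defs module's
index-free rendering `CritZerosInterlace` (all zeros ARE on the line by `lagarias2005_lemma_2_2_zeros`).
Printed proof: the phase `φ(t)` of `E(½+it) = |E(½+it)|e^{iφ(t)}` satisfies `|E(½+it)|² φ′(t) ≥ 0` (2.8) and is
non-constant (reflection principle), hence strictly increasing, while `A = |E| cos φ`, `B = −|E| sin φ` on the
line (the multiplicity clause needs `φ′ > 0`, de Branges' form of the lemma; Remark (2): no growth restriction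
on `E`). Users take `(h : lagarias2005_lemma_2_2_interlace)`. [cite: Lagarias2005, Lemma 2.2 (arXiv p. 6; held text p0005 L12)] -/
def lagarias2005_lemma_2_2_interlace : Prop :=
  ∀ E : ℂ → ℂ, Differentiable ℂ E → (∀ s : ℂ, 1 / 2 < s.re → ‖E (1 - conj s)‖ < ‖E s‖) →
    CritZerosInterlace (critRePart E) (critImPart E)

/-! ## Lemma 2.1 (2): the shift inequality under RH, and hypothesis (2.6) for `E_{h,θ}` -/

/-- **Lagarias 2005, Lemma 2.1 (2)** — RH-CONSEQUENCE, PROVED ("Assuming the Riemann hypothesis, the inequality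
(2.1) `|ξ(h + s)| > |ξ(h + 1 − s̄)|`, `Re(s) > ½`, holds for each `h > 0`"): from the tree's zero-free-half-plane
form of the term-by-term Hadamard-product argument (`norm_riemannXi_shift_reflect_lt_of_zeroFree` — the printed
proof of part (2): under RH every zero has `β = ½ < h + ½`) and `riemannZeta_ne_zero_of_riemannHypothesis`.
Part (1) (`h ≥ ½`, unconditional) is the tree's `lagarias2005_lemma_2_1` / `lagarias2005_lemma_2_1_holds`; the
`z`-variable form of part (2) is Lemma 6.1 (ii) (`lagarias2005_lemma_6_1_ii`, `lagarias2005_lemma_6_1_ii_iff`).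
The RH binder is explicit and never dropped. [cite: Lagarias2005, Lemma 2.1 (2) (arXiv pp. 4–5; held text p0004)] -/
theorem lagarias2005_lemma_2_1_2 (hRH : RiemannHypothesis) {h : ℝ} (hh : 0 < h) {s : ℂ} (hs : 1 / 2 < s.re) :
    ‖riemannXi (h + 1 - conj s)‖ < ‖riemannXi (h + s)‖ :=
  norm_riemannXi_shift_reflect_lt_of_zeroFree (ω₀ := 0)
    (fun w hw ↦ riemannZeta_ne_zero_of_riemannHypothesis hRH (by simp at hw; linarith)
      (by simp at hw; linarith)) hh hs

/-- `E_{h,θ}` satisfies hypothesis (2.6) of Lemma 2.2 for `h ≥ ½` ("Lemma 2.1 shows that under the stated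
assumptions `E(s) := E_h(s) = ξ(s+h)` satisfies the hypothesis (2.6) of Lemma 2.2 … The same holds more generally
for `E_{h,θ}(s) = e^{iθ}E_h(s)`"). RH-FREE, PROVED. (For `h ≤ −½` the inequality is REVERSED; Lagarias reduces to
`h ≥ 0` by `A_{−h} = A_h`, `B_{−h} = −B_h`, the Defs module's `diffXiA_neg`, `diffXiB_neg`.)
[cite: Lagarias2005, proof of Theorem 2.1 (arXiv p. 8; held text p0006)] -/
theorem diffXiErot_critHB {h : ℝ} (hh : 1 / 2 ≤ h) (θ : ℝ) :
    ∀ s : ℂ, 1 / 2 < s.re → ‖diffXiErot h θ (1 - conj s)‖ < ‖diffXiErot h θ s‖ := by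
  intro s hs
  have key := lagarias2005_lemma_2_1_holds h hh s hs
  have e1 : (1 : ℂ) - conj s + h = h + 1 - conj s := by ring
  have e2 : s + (h : ℂ) = h + s := by ring
  have h1 : ‖cexp (θ * I)‖ = 1 := by rw [Complex.norm_exp]; simp
  simp only [diffXiErot, e1, e2, norm_mul, h1, one_mul]
  exact key

/-- The same under RH for every `h > 0` — RH-CONSEQUENCE, PROVED from `lagarias2005_lemma_2_1_2`.
[cite: Lagarias2005, proof of Theorem 2.1 (arXiv p. 8; held text p0006)] -/
theorem diffXiErot_critHB_rh (hRH : RiemannHypothesis) {h : ℝ} (hh : 0 < h) (θ : ℝ) :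
    ∀ s : ℂ, 1 / 2 < s.re → ‖diffXiErot h θ (1 - conj s)‖ < ‖diffXiErot h θ s‖ := by
  intro s hs
  have key := lagarias2005_lemma_2_1_2 hRH hh hs
  have e1 : (1 : ℂ) - conj s + h = h + 1 - conj s := by ring
  have e2 : s + (h : ℂ) = h + s := by ring
  have h1 : ‖cexp (θ * I)‖ = 1 := by rw [Complex.norm_exp]; simp
  simp only [diffXiErot, e1, e2, norm_mul, h1, one_mul]
  exact key

/-! ## Printed elementary facts about `A_{h,θ}`, `B_{h,θ}` used by Theorem 2.1 -/

/-- `A_{h,θ}(½+it) = Re(e^{iθ} ξ(½+it+h))` (for `θ = 0`: "`A_h(½+it) = Re ξ(½+h+it)`", the Defs module's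
`diffXiA_critical`); this is the quantity whose vanishing the proof of Theorem 2.1 reads as "the real part of
`e^{iθ}ξ(s₀+h)` vanishes". [cite: Lagarias2005, §2 (arXiv pp. 4–5) and proof of Theorem 2.1 (arXiv p. 8; held text p0004, p0006)] -/
theorem diffXiArot_critical (h θ t : ℝ) :
    diffXiArot h θ (1 / 2 + t * I) = ((cexp (θ * I) * riemannXi (1 / 2 + t * I + h)).re : ℂ) := by
  rw [diffXiArot_eq_critRePart, critRePart_critical, diffXiErot_apply, diffXiE_apply]

/-- `B_{h,θ}(½+it) = −Im(e^{iθ} ξ(½+it+h))` (for `θ = 0`: "`B_h(½+it) = −Im ξ(½+h+it)`", the Defs module's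
`diffXiB_critical`). [cite: Lagarias2005, §2 (arXiv pp. 4–5) and proof of Theorem 2.1 (arXiv p. 8; held text p0004, p0006)] -/
theorem diffXiBrot_critical (h θ t : ℝ) :
    diffXiBrot h θ (1 / 2 + t * I) = ((-(cexp (θ * I) * riemannXi (1 / 2 + t * I + h)).im : ℝ) : ℂ) := by
  rw [diffXiBrot_eq_critImPart, critImPart_critical, diffXiErot_apply, diffXiE_apply]

/-- "… and similarly for `B_h(s)`": the `B`-companion of the printed symmetry `A_h(s̄) = conj A_h(s)` (the Defs
module's `diffXiA_conj`) carries a SIGN, `B_h(s̄) = −conj B_h(s)` (the factor `1/2i` is imaginary; on the critical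
line `B_h` is real and odd under `t ↦ −t`). RH-FREE, PROVED. [cite: Lagarias2005, §2, after (2.1) (arXiv pp. 4–5; held text p0004)] -/
theorem diffXiB_conj (h : ℝ) (s : ℂ) : diffXiB h (conj s) = -conj (diffXiB h s) := by
  have hc : ∀ w : ℂ, conj (riemannXi w) = riemannXi (conj w) := fun w ↦ (riemannXi_conj_holds w).symm
  simp only [diffXiB, map_div₀, map_mul, map_sub, map_add, hc, Complex.conj_ofReal, map_ofNat, Complex.conj_I]
  ring

/-! ## Theorem 2.1 -/

/-- NAMED FACT — **Lagarias 2005, Theorem 2.1 (1)** — RH-FREE: "For `|h| ≥ ½` and any `0 ≤ θ < 2π`, the entire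
functions `A_{h,θ}(s)` and `B_{h,θ}(s)` have all their zeros on the critical line `Re(s) = ½`. These zeros are
all simple zeros, and they interlace." (same shape as the `L(s,χ)` analogue `lagarias2005_thm_5_1_1`). Printed
proof: Lemma 2.1 (1) + Lemma 2.2; simplicity because a multiple zero would be a common zero of `A_{h,θ}` and
`B_{h,θ}`, i.e. a zero `ρ₀ = s₀ + h` of `ξ` with `Re ρ₀ = ½ + h ≥ 1`. (Lagarias: known to de Branges in the late
1980's.) Discharged in `LagariasDifferencedXiProofs.lean`; users take `(h : lagarias2005_thm_2_1_1)`.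
[cite: Lagarias2005, Theorem 2.1 (1) (arXiv p. 8; held text p0006 L25)] -/
def lagarias2005_thm_2_1_1 : Prop :=
  ∀ h θ : ℝ, 1 / 2 ≤ |h| → 0 ≤ θ → θ < 2 * Real.pi →
    AllZerosOnCriticalLine (diffXiArot h θ) ∧ AllZerosOnCriticalLine (diffXiBrot h θ) ∧
      AllZerosSimple (diffXiArot h θ) ∧ AllZerosSimple (diffXiBrot h θ) ∧
        CritZerosInterlace (diffXiArot h θ) (diffXiBrot h θ)

/-- NAMED FACT — **Lagarias 2005, Theorem 2.1 (2)** — RH-CONSEQUENCE (printed "Assuming the Riemann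
hypothesis"; the binder is explicit): under RH, for `0 < |h| < ½` and any `0 ≤ θ < 2π`, `A_{h,θ}` and `B_{h,θ}`
have all their zeros on the critical line, all simple, and they interlace. Discharged in
`LagariasDifferencedXiProofs.lean` (the RH binder stays a hypothesis); users take `(h : lagarias2005_thm_2_1_2)`.
[cite: Lagarias2005, Theorem 2.1 (2) (arXiv p. 8; held text p0006 L25)] -/
def lagarias2005_thm_2_1_2 : Prop :=
  RiemannHypothesis → ∀ h θ : ℝ, 0 < |h| → |h| < 1 / 2 → 0 ≤ θ → θ < 2 * Real.pi →
    AllZerosOnCriticalLine (diffXiArot h θ) ∧ AllZerosOnCriticalLine (diffXiBrot h θ) ∧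
      AllZerosSimple (diffXiArot h θ) ∧ AllZerosSimple (diffXiBrot h θ) ∧
        CritZerosInterlace (diffXiArot h θ) (diffXiBrot h θ)

/-! ## Theorem 3.1: global asymptotics of the zeros -/

/-- The main term `(1/π) T log T − (1/π)(log(2π) + 1) T` of (3.1) (the same main term serves the `L(s,χ)`
analogue of §5). [cite: Lagarias2005, Theorem 3.1, (3.1) (arXiv p. 9; held text p0007 L10)] -/
def lagariasZeroCountMain (T : ℝ) : ℝ := T * Real.log T / π - (Real.log (2 * π) + 1) * T / π

/-- NAMED FACT — **Lagarias 2005, Theorem 3.1 (1)** — RH-FREE: "For `|h| ≥ ½` and any `0 ≤ θ < 2π`, then for all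
`T ≥ 2` there holds `N(T, A_{h,θ}) = (1/π) T log T − (1/π)(log(2π) + 1) T + O(log T)` (3.1) … A similar formula
holds for `N(T, B_{h,θ})`", with `N(T, F)` = `stripZeroCount F T` (zeros with `|Im s| ≤ T`, with multiplicity).
SCOPE OF THE CONSTANT: the paper adds "the implied constant in the `O`-notation is independent of `h` and `θ`".
Independence of `θ` is recorded; independence of `h` over the whole range `|h| ≥ ½` is NOT — it cannot hold: for
fixed `T` the count `N(T, A_{h,θ})` tends to infinity as `h → ∞` (the phase of `ξ(½ + h + it)` has velocity
`Re ξ′/ξ(½ + h + it)`, which is `≍ ½ log h` uniformly in `|t| ≤ T`; cf. `Lagarias1999_thm12_rat`), while the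
right side of (3.1) stays bounded; the printed proof treats `h` as fixed (the `h`-dependence of (3.4) sits in its
`O`-term). So the constant here may depend on `h` (printed "`|T| ≥ 2`" read as `T ≥ 2`). Users take
`(h : lagarias2005_thm_3_1_1)`. [cite: Lagarias2005, Theorem 3.1 (1) (arXiv p. 9; held text p0007 L10)] -/
def lagarias2005_thm_3_1_1 : Prop :=
  ∀ h : ℝ, 1 / 2 ≤ |h| → ∃ C : ℝ, ∀ θ T : ℝ, 0 ≤ θ → θ < 2 * Real.pi → 2 ≤ T →
    |(stripZeroCount (diffXiArot h θ) T : ℝ) - lagariasZeroCountMain T| ≤ C * Real.log T ∧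
      |(stripZeroCount (diffXiBrot h θ) T : ℝ) - lagariasZeroCountMain T| ≤ C * Real.log T

/-- NAMED FACT — **Lagarias 2005, Theorem 3.1 (2)** — RH-CONSEQUENCE (explicit binder): "Assuming the Riemann
hypothesis, the formula (3.1) for `N(T, A_{h,θ})` is valid for all nonzero `h`. A similar formula holds for
`N(T, B_{h,θ})` for all nonzero `h`" (constant depending on `h`, uniform in `θ`, as in part (1)). Users take
`(h : lagarias2005_thm_3_1_2)`. [cite: Lagarias2005, Theorem 3.1 (2) (arXiv p. 9; held text p0007 L10)] -/
def lagarias2005_thm_3_1_2 : Prop :=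
  RiemannHypothesis → ∀ h : ℝ, h ≠ 0 → ∃ C : ℝ, ∀ θ T : ℝ, 0 ≤ θ → θ < 2 * Real.pi → 2 ≤ T →
    |(stripZeroCount (diffXiArot h θ) T : ℝ) - lagariasZeroCountMain T| ≤ C * Real.log T ∧
      |(stripZeroCount (diffXiBrot h θ) T : ℝ) - lagariasZeroCountMain T| ≤ C * Real.log T

end Literature.NumberTheory.LFunctions
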